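import Mathlib.Algebra.QuaternionBasis
import Mathlib.LinearAlgebra.Matrix.ToLin
import Mathlib.LinearAlgebra.Dual.Lemmas
import Mathlib.Algebra.Polynomial.Roots
import Mathlib.LinearAlgebra.BilinearForm.Basic
import Mathlib.Analysis.SpecialFunctions.Pow.Real
import HarnessLib

/-!
# Quaternionic coordinates of a type-II Weil frame and an explicit algebraic family of points of the
# type-II sub-domain `𝔖(j)` through its diagonal CM point (Shimura's families of type II)

Family `hodge`, layer `Literature/AlgebraicGeometry/Motives`; THEOREMS plus one auxiliary `structure`
(no named fact, no `sorry`; D-0026). Sequel to `Motives/WeilTypeIIComplexStructures` (the type-II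
sub-domain `𝔖(j) ⊂ X⁺(D)` of a Weil datum with a Rosati-symmetric `K`-antilinear `j`, `j² = b > 0`, is
non-empty and `j` is a Hodge endomorphism on it) and to `Motives/WeilDiscriminantTypeII` (the `j`-adapted
orthogonal frame: a rational Weil datum of type II is `D x₁ ⊕ … ⊕ D xₙ`, `D = K ⊕ Kj = (-d, b)_ℚ`).

CONTEXT (route SplitImpliesAll, crux `NonsplitSixfoldCells`, the "GENERIC type-II member" = a member of a
non-split sixfold cell with `End⁰ = D_δ` exactly). Shimura [Shimura1963AnalyticFamilies, §4] proves that the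
generic member of the analytic family of polarized abelian varieties with endomorphism structure of TYPE II
(indefinite quaternion algebra `D` over `ℚ`; the family is parametrized by a Siegel space `𝔖ₙ`) has
endomorphism algebra exactly `D`; van Geemen [vanGeemen1994HodgeAV, proof of Thm. 6.11] gives the
Hodge-theoretic mechanism on the Weil domain ("`Hₙ = {gJ'g⁻¹ : g ∈ SU_H(ℝ)}` … the general `J' ∈ Hₙ`":
a rational endomorphism commuting with the general complex structure commutes with a whole algebraic family
of them). The proof of that statement for `𝔖(j)` needs an EXPLICIT ALGEBRAIC FAMILY of points of `𝔖(j)`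
whose joint commutant is `D_ℝ`; this file constructs the family and its coordinate calculus (the commutant
computation and the `ℚ`-descent to `End_Hdg = D` are the sequel):

* §0 the real quaternion algebra `D_ℝ = ℍ[ℝ,-d,b]` (`i² = -d`, `j² = b = β²`): the adjoint involution `†`
  (`i ↦ -i`, `j ↦ j`), the idempotents `u± = ½ ± j/(2β)` (`u₊ + u₋ = 1`, `u₊u₋ = 0`, `i u₊ = u₋ i`), the
  one-parameter "torus" `γ(P) = P u₊ + P⁻¹ u₋` (`γ(P) γ(P⁻¹) = 1`, `(γ m γ).imI = m.imI`,
  `γ(P⁻¹) i γ(P) = P² · i u₊ + P⁻² · i u₋`), and the positivity identity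
  `(g† g i).imI = g₀² + d g₁² + b g₂² + bd g₃²`;
* §1 a TYPE-II QUATERNIONIC FRAME (`Frame W n d b β`): a real vector space `W` with operators `A, B`
  (`A² = -d`, `B² = b`, `AB = -BA`), an alternating form `E` (`E(Av, w) = -E(v, Aw)`,
  `E(Bv, w) = E(v, Bw)`) and a basis `x i, A x i, B x i, AB x i` (`i < n`) of `E`-ORTHOGONAL blocks with
  `E(x i, A x i) > 0` — what the `j`-adapted frame of `Motives/WeilDiscriminantTypeII` provides on `V_ℝ`
  (`A = α_ℝ`, `B = j_ℝ`, `E = E_ℝ`); the left action `λ : D_ℝ → End W` (`i ↦ A`, `j ↦ B`;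
  `E(λ(δ)v, w) = E(v, λ(δ†)w)`), the coordinate isomorphism `Φ : D_ℝⁿ ≃ W`, `Φ(g) = Σᵢ λ(gᵢ) xᵢ`
  (`Φ(δg) = λ(δ)Φ(g)`), the `D_ℝ`-linear operators `ρ(M) : Φ(g) ↦ Φ(gM)` (`M ∈ Mₙ(D_ℝ)`;
  `ρ(M)ρ(N) = ρ(NM)`, `ρ` commutes with `λ`), and the GRAM FORMULA `E(Φ g, Φ h) = Σᵢ qᵢ (gᵢ† hᵢ).imI`,
  `qᵢ = E(xᵢ, Axᵢ) > 0` (`Frame.E_Φ`), with the isometry criterion `Frame.E_ρ_ρ`;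
* §2 the explicit family: `Dq = diag(i)` (`⟪gDq, hDq⟫ = d⟪g, h⟫`, `⟪h, hDq⟫ > 0` for `h ≠ 0` — the base
  point `d^{-1/2} ρ(Dq)` is the diagonal CM point of `𝔖(j)`), the torus `Γ(P) = diag γ(Pᵢ)` (isometries),
  the nilpotent `σ ∈ Mₙ(D_ℝ)` (`σᵢ₀ = u₊`, `σ₀ᵢ = -(q₀/qᵢ)u₋`; `σ² = 0`, `E`-skew and `E`-null, so the
  unipotents `1 + tσ` are isometries: `Frame.ip_unipotent`), and for `t > 0`
  **`J(t) = d^{-1/2} · ρ((1 - tσ) Γ(P)⁻¹ Dq Γ(P) (1 + tσ))`**, `Pᵢ = t^{e(i)}` (`e(0) = 1`, `e(i) = 2i + 2`;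
  the exponents are chosen so that the Laurent coefficients of `J(t)` in `t` isolate the matrix units
  `Eᵢᵢ(iu±)` and the gluing elements `Eᵢ₀(iu₊) + (q₀/qᵢ)E₀ᵢ(iu₊)`, whose joint commutant is `λ(D_ℝ)`):
  **`Frame.J_J`** `J(t)² = -1`, **`Frame.E_J_J`** `E(Jv, Jw) = E(v, w)`, **`Frame.E_J_pos`** `E(v, Jv) > 0`
  (`v ≠ 0`), **`Frame.lam_J`** `J(t)` commutes with `λ(D_ℝ)` (so `Frame.A_J`, `Frame.B_J`: with `A = α`
  and `B = j`). These are POINTS OF THE TYPE-II SUB-DOMAIN in Deligne's real form (`X⁺`: `J² = -1`,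
  `K`-linear, `E(Jx, Jy) = E(x, y)`, `E(x, Jx) > 0` [Deligne1982HodgeCycles, proof of Thm. 4.8 (a′), (b′)];
  type II: `JB = BJ`) — an explicit real-ALGEBRAIC `(1-parameter)` family through the diagonal CM point
  leaving every `D_ℝ`-block-decomposition (the unipotent factor glues block `0` to all other blocks).

HONEST REMARKS. (1) NOT here: the Laurent-coefficient extraction and the commutant theorem "an `ℝ`-linear
`f` commuting with all `J(t)` lies in `λ(D_ℝ)`", the `ℚ`-descent `End_ℚ(V) ∩ D_ℝ = D`, and the `endAlg`
packaging on a `WeilDatum` (sequel; design recorded in the vhodge cell, memos/TYPER1-g5-*). Hence nothing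
in this file yet says that any member has endomorphism algebra `D`. (2) Nothing here is about abelian
varieties or the Hodge conjecture: no period map, no Riemann theorem. (3) `D_ℝ ≅ M₂(ℝ)` and `𝔖(j) ≅`
Siegel space are not formalized.

## References

* [Shimura1963AnalyticFamilies] G. Shimura, On analytic families of polarized abelian varieties and
  automorphic functions, Ann. of Math. 78 (1963), §4 (Type II: the domain is a Siegel space; endomorphism
  algebra of the generic member).
* [vanGeemen1994HodgeAV] B. van Geemen, An introduction to the Hodge conjecture for abelian varieties,
  LNM 1594 (1994), 5.5–5.10 and proof of Thm. 6.11 ("general member": the conjugates `gJ'g⁻¹`).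
* [vanGeemenVerra2003QuaternionicPryms] B. van Geemen, A. Verra, Topology 42 (2003), Lemma 4.5 (proof:
  `F = K ⊕ Kj`, `xj = j x̄`).
* [Deligne1982HodgeCycles] P. Deligne, LNM 900 (1982), proof of Thm. 4.8, pp. 47–49 (`X⁺`, (a′), (b′)).
-/

noncomputable section

open Module Matrix Finset
open scoped Quaternion

namespace Literature.AlgebraicGeometry.Motives

universe u

namespace TypeIIQuaternionFrame

/-! ## §0 The real quaternion algebra `D_ℝ = ℍ[ℝ,-d,b]` -/

section Quaternion

variable {d b β : ℝ}

/-- The adjoint anti-involution `†` of `D_ℝ = ℍ[ℝ,-d,b]` for a Weil form and the left action: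
`1, j, k` are fixed, `i ↦ -i` (`E(αv, w) = -E(v, αw)`, `E(jv, w) = E(v, jw)`). [cite: vanGeemenVerra2003QuaternionicPryms, Lemma 4.5 (proof)] -/
def dag (x : ℍ[ℝ,-d,b]) : ℍ[ℝ,-d,b] := ⟨x.re, -x.imI, x.imJ, x.imK⟩

/-- `dag_re` (auxiliary). [cite: vanGeemenVerra2003QuaternionicPryms, Lemma 4.5 (proof)] -/
@[simp] theorem dag_re (x : ℍ[ℝ,-d,b]) : (dag x).re = x.re := rfl
/-- `dag_imI` (auxiliary). [cite: vanGeemenVerra2003QuaternionicPryms, Lemma 4.5 (proof)] -/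
@[simp] theorem dag_imI (x : ℍ[ℝ,-d,b]) : (dag x).imI = -x.imI := rfl
/-- `dag_imJ` (auxiliary). [cite: vanGeemenVerra2003QuaternionicPryms, Lemma 4.5 (proof)] -/
@[simp] theorem dag_imJ (x : ℍ[ℝ,-d,b]) : (dag x).imJ = x.imJ := rfl
/-- `dag_imK` (auxiliary). [cite: vanGeemenVerra2003QuaternionicPryms, Lemma 4.5 (proof)] -/
@[simp] theorem dag_imK (x : ℍ[ℝ,-d,b]) : (dag x).imK = x.imK := rfl

/-- `†` is an anti-automorphism. [cite: vanGeemenVerra2003QuaternionicPryms, Lemma 4.5 (proof)] -/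
theorem dag_mul (x y : ℍ[ℝ,-d,b]) : dag (x * y) = dag y * dag x := by
  ext <;> simp <;> ring

/-- `†` is additive. [cite: vanGeemenVerra2003QuaternionicPryms, Lemma 4.5 (proof)] -/
theorem dag_add (x y : ℍ[ℝ,-d,b]) : dag (x + y) = dag x + dag y := by
  ext <;> simp; ring

/-- `†` is `ℝ`-linear. [cite: vanGeemenVerra2003QuaternionicPryms, Lemma 4.5 (proof)] -/
theorem dag_smul (r : ℝ) (x : ℍ[ℝ,-d,b]) : dag (r • x) = r • dag x := by
  ext <;> simp

/-- `†(-x) = -†x`. [cite: vanGeemenVerra2003QuaternionicPryms, Lemma 4.5 (proof)] -/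
theorem dag_neg (x : ℍ[ℝ,-d,b]) : dag (-x) = -dag x := by
  ext <;> simp

/-- `†` commutes with finite sums. [cite: vanGeemenVerra2003QuaternionicPryms, Lemma 4.5 (proof)] -/
theorem dag_sum {ι : Type*} (s : Finset ι) (f : ι → ℍ[ℝ,-d,b]) :
    dag (∑ i ∈ s, f i) = ∑ i ∈ s, dag (f i) := by
  classical
  induction s using Finset.induction_on with
  | empty => ext <;> simp [dag]
  | insert a s ha ih => rw [Finset.sum_insert ha, Finset.sum_insert ha, dag_add, ih]

/-- The `imI`-component commutes with finite sums. [cite: vanGeemenVerra2003QuaternionicPryms, Lemma 4.5 (proof)] -/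
theorem imI_sum {ι : Type*} (s : Finset ι) (f : ι → ℍ[ℝ,-d,b]) :
    (∑ i ∈ s, f i).imI = ∑ i ∈ s, (f i).imI := by
  classical
  induction s using Finset.induction_on with
  | empty => simp
  | insert a s ha ih => rw [Finset.sum_insert ha, Finset.sum_insert ha, ← ih]; rfl

/-- `neg_imI'` (auxiliary). [cite: vanGeemenVerra2003QuaternionicPryms, Lemma 4.5 (proof)] -/
theorem neg_imI' (x : ℍ[ℝ,-d,b]) : (-x).imI = -x.imI := rfl
/-- `smul_imI'` (auxiliary). [cite: vanGeemenVerra2003QuaternionicPryms, Lemma 4.5 (proof)] -/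
theorem smul_imI' (r : ℝ) (x : ℍ[ℝ,-d,b]) : (r • x).imI = r * x.imI := rfl
/-- `zero_imI'` (auxiliary). [cite: vanGeemenVerra2003QuaternionicPryms, Lemma 4.5 (proof)] -/
theorem zero_imI' : (0 : ℍ[ℝ,-d,b]).imI = 0 := rfl

/-- `i ∈ D_ℝ`. [cite: vanGeemenVerra2003QuaternionicPryms, Lemma 4.5 (proof)] -/
def qi (d b : ℝ) : ℍ[ℝ,-d,b] := ⟨0, 1, 0, 0⟩
/-- `j ∈ D_ℝ`. [cite: vanGeemenVerra2003QuaternionicPryms, Lemma 4.5 (proof)] -/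
def qj (d b : ℝ) : ℍ[ℝ,-d,b] := ⟨0, 0, 1, 0⟩
/-- The idempotent `u₊ = ½ + j/(2β)` (`β² = b`): `u₊ D_ℝ`-coordinates cut out `W₊ = ker(j - β)`.
[cite: vanGeemen1994HodgeAV, 5.5–5.6] -/
def up (d b β : ℝ) : ℍ[ℝ,-d,b] := ⟨2⁻¹, 0, (2 * β)⁻¹, 0⟩
/-- The idempotent `u₋ = ½ - j/(2β)`. [cite: vanGeemen1994HodgeAV, 5.5–5.6] -/
def um (d b β : ℝ) : ℍ[ℝ,-d,b] := ⟨2⁻¹, 0, -(2 * β)⁻¹, 0⟩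
/-- The torus element `γ(P) = P u₊ + P⁻¹ u₋` (an `E`-isometry of each coordinate block).
[cite: vanGeemen1994HodgeAV, proof of Thm. 6.11] -/
def gam (d b β P : ℝ) : ℍ[ℝ,-d,b] := P • up d b β + P⁻¹ • um d b β

/-- A quaternion is the combination of `1, i, j, ij` with its components. [cite: vanGeemenVerra2003QuaternionicPryms, Lemma 4.5 (proof)] -/
theorem decomp (x : ℍ[ℝ,-d,b]) :
    x = x.re • (1 : ℍ[ℝ,-d,b]) + x.imI • qi d b + x.imJ • qj d b + x.imK • (qi d b * qj d b) := by
  ext <;> simp [qi, qj]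

/-- `i² = -d`. [cite: vanGeemenVerra2003QuaternionicPryms, Lemma 4.5 (proof)] -/
theorem qi_mul_qi : qi d b * qi d b = (-d) • (1 : ℍ[ℝ,-d,b]) := by
  ext <;> simp [qi]

/-- `dag_qi` (auxiliary). [cite: vanGeemenVerra2003QuaternionicPryms, Lemma 4.5 (proof)] -/
theorem dag_qi : dag (qi d b) = -qi d b := by ext <;> simp [qi, dag]
/-- `dag_up` (auxiliary). [cite: vanGeemenVerra2003QuaternionicPryms, Lemma 4.5 (proof)] -/
theorem dag_up : dag (up d b β) = up d b β := by ext <;> simp [up, dag]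
/-- `dag_um` (auxiliary). [cite: vanGeemenVerra2003QuaternionicPryms, Lemma 4.5 (proof)] -/
theorem dag_um : dag (um d b β) = um d b β := by ext <;> simp [um, dag]
/-- `dag_gam` (auxiliary). [cite: vanGeemenVerra2003QuaternionicPryms, Lemma 4.5 (proof)] -/
theorem dag_gam (P : ℝ) : dag (gam d b β P) = gam d b β P := by
  rw [gam, dag_add, dag_smul, dag_smul, dag_up, dag_um]

/-- `u₊ + u₋ = 1`. [cite: vanGeemenVerra2003QuaternionicPryms, Lemma 4.5 (proof)] -/
theorem up_add_um : up d b β + um d b β = 1 := by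
  ext <;> simp [up, um]; norm_num

/-- `i u₊ = u₋ i`. [cite: vanGeemenVerra2003QuaternionicPryms, Lemma 4.5 (proof)] -/
theorem qi_mul_up : qi d b * up d b β = um d b β * qi d b := by
  ext <;> simp [qi, up, um]

/-- `i u₋ = u₊ i`. [cite: vanGeemenVerra2003QuaternionicPryms, Lemma 4.5 (proof)] -/
theorem qi_mul_um : qi d b * um d b β = up d b β * qi d b := by
  ext <;> simp [qi, up, um]

/-- `(i m i).imI = -d · m.imI`. [cite: vanGeemenVerra2003QuaternionicPryms, Lemma 4.5 (proof)] -/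
theorem imI_qi_mul_mul_qi (m : ℍ[ℝ,-d,b]) : (qi d b * m * qi d b).imI = -d * m.imI := by
  simp [qi]

/-- POSITIVITY: `(g† g i).imI = g₀² + d g₁² + b g₂² + bd g₃²`. [cite: vanGeemen1994HodgeAV, 5.6–5.7] -/
theorem imI_dag_mul_self_mul_qi (g : ℍ[ℝ,-d,b]) :
    (dag g * g * qi d b).imI = g.re ^ 2 + d * g.imI ^ 2 + b * g.imJ ^ 2 + b * d * g.imK ^ 2 := by
  simp [qi, dag]; ring

/-- `(u₊ m).imI = (m u₋).imI`. [cite: vanGeemenVerra2003QuaternionicPryms, Lemma 4.5 (proof)] -/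
theorem imI_up_mul (m : ℍ[ℝ,-d,b]) : (up d b β * m).imI = (m * um d b β).imI := by
  simp [up, um]; ring

/-- `(m u₊).imI = (u₋ m).imI`. [cite: vanGeemenVerra2003QuaternionicPryms, Lemma 4.5 (proof)] -/
theorem imI_mul_up (m : ℍ[ℝ,-d,b]) : (m * up d b β).imI = (um d b β * m).imI := by
  simp [up, um]; ring

section Beta

variable (hβ : β * β = b) (hβ0 : β ≠ 0)
include hβ hβ0

/-- `u₊ u₋ = 0`. [cite: vanGeemenVerra2003QuaternionicPryms, Lemma 4.5 (proof)] -/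
theorem up_mul_um : up d b β * um d b β = 0 := by
  subst hβ; ext <;> simp [up, um] <;> field_simp <;> ring

/-- `u₋ u₊ = 0`. [cite: vanGeemenVerra2003QuaternionicPryms, Lemma 4.5 (proof)] -/
theorem um_mul_up : um d b β * up d b β = 0 := by
  subst hβ; ext <;> simp [up, um] <;> field_simp <;> ring

/-- `u₊² = u₊`. [cite: vanGeemenVerra2003QuaternionicPryms, Lemma 4.5 (proof)] -/
theorem up_mul_up : up d b β * up d b β = up d b β := by
  subst hβ; ext <;> simp [up] <;> field_simp <;> ring

/-- `u₋² = u₋`. [cite: vanGeemenVerra2003QuaternionicPryms, Lemma 4.5 (proof)] -/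
theorem um_mul_um : um d b β * um d b β = um d b β := by
  subst hβ; ext <;> simp [um] <;> field_simp <;> ring

omit hβ in
/-- `j = β (u₊ - u₋)`. [cite: vanGeemenVerra2003QuaternionicPryms, Lemma 4.5 (proof)] -/
theorem qj_eq : qj d b = β • (up d b β - um d b β) := by
  ext <;> simp [qj, up, um]
  field_simp
  norm_num

/-- `(u₊ m u₊).imI = 0`. [cite: vanGeemenVerra2003QuaternionicPryms, Lemma 4.5 (proof)] -/
theorem imI_up_sandwich (m : ℍ[ℝ,-d,b]) : (up d b β * m * up d b β).imI = 0 := by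
  rw [imI_mul_up, ← mul_assoc, um_mul_up hβ hβ0, zero_mul]; simp

/-- `(u₋ m u₋).imI = 0`. [cite: vanGeemenVerra2003QuaternionicPryms, Lemma 4.5 (proof)] -/
theorem imI_um_sandwich (m : ℍ[ℝ,-d,b]) : (um d b β * m * um d b β).imI = 0 := by
  rw [mul_assoc, ← imI_mul_up, mul_assoc, um_mul_up hβ hβ0, mul_zero]; simp

/-- `γ(P) γ(P⁻¹) = 1`. [cite: vanGeemenVerra2003QuaternionicPryms, Lemma 4.5 (proof)] -/
theorem gam_mul_gam_inv {P : ℝ} (hP : P ≠ 0) : gam d b β P * gam d b β P⁻¹ = 1 := by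
  subst hβ; ext <;> simp [gam, up, um] <;> field_simp <;> ring

/-- `γ(P⁻¹) γ(P) = 1`. [cite: vanGeemenVerra2003QuaternionicPryms, Lemma 4.5 (proof)] -/
theorem gam_inv_mul_gam {P : ℝ} (hP : P ≠ 0) : gam d b β P⁻¹ * gam d b β P = 1 := by
  subst hβ; ext <;> simp [gam, up, um] <;> field_simp <;> ring

/-- `γ` is an isometry of the block form: `(γ m γ).imI = m.imI`. [cite: vanGeemen1994HodgeAV, proof of Thm. 6.11] -/
theorem imI_gam_sandwich {P : ℝ} (hP : P ≠ 0) (m : ℍ[ℝ,-d,b]) :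
    (gam d b β P * m * gam d b β P).imI = m.imI := by
  subst hβ; simp [gam, up, um]; field_simp; ring

/-- Conjugating `i` by the torus: `γ(P⁻¹) i γ(P) = P² · i u₊ + P⁻² · i u₋`.
[cite: vanGeemen1994HodgeAV, proof of Thm. 6.11] -/
theorem gam_inv_qi_gam {P : ℝ} (hP : P ≠ 0) :
    gam d b β P⁻¹ * qi d b * gam d b β P =
      (P ^ 2) • (qi d b * up d b β) + (P ^ 2)⁻¹ • (qi d b * um d b β) := by
  subst hβ; ext <;> simp [gam, up, um, qi] <;> field_simp <;> ring

end Beta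

end Quaternion

/-! ## §1 Type-II quaternionic frames, the left action `λ`, coordinates `Φ`, right operators `ρ` -/

/-- A TYPE-II QUATERNIONIC FRAME on a real vector space `W`: operators `A` (`A² = -d`), `B` (`B² = b`,
`AB = -BA`), an alternating form `E` with `E(Av, w) = -E(v, Aw)`, `E(Bv, w) = E(v, Bw)`, and a basis
`bas (i, ε)` with `bas (i, 1) = A xᵢ`, `bas (i, 2) = B xᵢ`, `bas (i, 3) = AB xᵢ` (`xᵢ = bas (i, 0)`) whose
blocks `i ≠ k` are `E`-orthogonal and `E(xᵢ, Axᵢ) > 0`; `β > 0` is the chosen square root of `b`.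
On `V_ℝ` this is the realification of the `j`-adapted orthogonal frame of a rational Weil datum of
type II (`A = α`, `B = j`). [cite: vanGeemenVerra2003QuaternionicPryms, Lemma 4.5]
[cite: vanGeemen1994HodgeAV, 5.3–5.6] -/
structure Frame (W : Type u) [AddCommGroup W] [Module ℝ W] (n : ℕ) (d b β : ℝ) where
  /-- the operator `α_ℝ` -/
  A : W →ₗ[ℝ] W
  /-- the operator `j_ℝ` -/
  B : W →ₗ[ℝ] W
  /-- the alternating Weil form -/
  E : LinearMap.BilinForm ℝ W
  /-- the frame basis `xᵢ, Axᵢ, Bxᵢ, ABxᵢ` -/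
  bas : Module.Basis (Fin n × Fin 4) ℝ W
  d_pos : 0 < d
  β_pos : 0 < β
  β_mul_β : β * β = b
  A_A : ∀ w, A (A w) = -(d • w)
  B_B : ∀ w, B (B w) = b • w
  A_B : ∀ w, A (B w) = -(B (A w))
  E_swap : ∀ v w, E w v = -(E v w)
  E_A : ∀ v w, E (A v) w = -(E v (A w))
  E_B : ∀ v w, E (B v) w = E v (B w)
  bas_one : ∀ i, bas (i, 1) = A (bas (i, 0))
  bas_two : ∀ i, bas (i, 2) = B (bas (i, 0))
  bas_three : ∀ i, bas (i, 3) = A (B (bas (i, 0)))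
  orth : ∀ i k : Fin n, i ≠ k → ∀ ε ε' : Fin 4, E (bas (i, ε)) (bas (k, ε')) = 0
  pos : ∀ i, 0 < E (bas (i, 0)) (A (bas (i, 0)))

/-- Right multiplication by a quaternionic matrix on row vectors, `g ↦ g M`, as an `ℝ`-linear map.
[cite: vanGeemen1994HodgeAV, 5.3–5.6] -/
def vecMulₗ {n : ℕ} {d b : ℝ} (M : Matrix (Fin n) (Fin n) ℍ[ℝ,-d,b]) :
    (Fin n → ℍ[ℝ,-d,b]) →ₗ[ℝ] (Fin n → ℍ[ℝ,-d,b]) where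
  toFun g := g ᵥ* M
  map_add' g h := Matrix.add_vecMul M g h
  map_smul' r g := by
    rw [RingHom.id_apply, Matrix.smul_vecMul]

/-- `vecMulₗ_apply` (auxiliary). [cite: vanGeemen1994HodgeAV, 5.3–5.6] -/
@[simp] theorem vecMulₗ_apply {n : ℕ} {d b : ℝ} (M : Matrix (Fin n) (Fin n) ℍ[ℝ,-d,b])
    (g : Fin n → ℍ[ℝ,-d,b]) : vecMulₗ M g = g ᵥ* M := rfl

/-- `(δ g) M = δ (g M)`: right multiplication is left-`D_ℝ`-linear. [cite: vanGeemen1994HodgeAV, 5.3–5.6] -/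
theorem smul_vecMul_quat {n : ℕ} {d b : ℝ} (δ : ℍ[ℝ,-d,b]) (g : Fin n → ℍ[ℝ,-d,b])
    (M : Matrix (Fin n) (Fin n) ℍ[ℝ,-d,b]) : (δ • g) ᵥ* M = δ • (g ᵥ* M) := by
  funext k
  simp [Matrix.vecMul, dotProduct, Finset.mul_sum, mul_assoc]

/-- `g Eᵢⱼ(c) = δⱼ (gᵢ c)`. [cite: vanGeemen1994HodgeAV, 5.3–5.6] -/
theorem vecMul_single {n : ℕ} {d b : ℝ} (g : Fin n → ℍ[ℝ,-d,b]) (i j : Fin n) (c : ℍ[ℝ,-d,b]) :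
    g ᵥ* Matrix.single i j c = Pi.single j (g i * c) := by
  funext k
  by_cases hk : k = j
  · subst hk
    simp only [Matrix.vecMul, dotProduct, Pi.single_eq_same]
    rw [Finset.sum_eq_single_of_mem i (Finset.mem_univ i)]
    · simp [Matrix.single]
    · intro l _ hl; simp [Matrix.single, Ne.symm hl]
  · simp only [Matrix.vecMul, dotProduct, Pi.single_eq_of_ne hk]
    exact Finset.sum_eq_zero fun l _ => by simp [Matrix.single, Ne.symm hk]

namespace Frame

variable {W : Type u} [AddCommGroup W] [Module ℝ W] {n : ℕ} {d b β : ℝ} (F : Frame W n d b β)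

/-- `b_pos` (auxiliary). [cite: vanGeemen1994HodgeAV, 5.3–5.6] -/
theorem b_pos (F : Frame W n d b β) : 0 < b := by rw [← F.β_mul_β]; exact mul_pos F.β_pos F.β_pos
/-- `β_ne` (auxiliary). [cite: vanGeemen1994HodgeAV, 5.3–5.6] -/
theorem β_ne (F : Frame W n d b β) : β ≠ 0 := F.β_pos.ne'
/-- `d_ne` (auxiliary). [cite: vanGeemen1994HodgeAV, 5.3–5.6] -/
theorem d_ne (F : Frame W n d b β) : d ≠ 0 := F.d_pos.ne'

/-- The frame vectors `xᵢ`. [cite: vanGeemen1994HodgeAV, 5.3–5.6] -/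
def x (i : Fin n) : W := F.bas (i, 0)
/-- The block constants `qᵢ = E(xᵢ, Axᵢ) > 0`. [cite: vanGeemen1994HodgeAV, 5.3–5.6] -/
def q (i : Fin n) : ℝ := F.E (F.x i) (F.A (F.x i))
/-- `q_pos` (auxiliary). [cite: vanGeemen1994HodgeAV, 5.3–5.6] -/
theorem q_pos (i : Fin n) : 0 < F.q i := F.pos i
/-- `q_ne` (auxiliary). [cite: vanGeemen1994HodgeAV, 5.3–5.6] -/
theorem q_ne (i : Fin n) : F.q i ≠ 0 := (F.q_pos i).ne'

/-- `A, B` satisfy the defining relations of `ℍ[ℝ,-d,b]`. [cite: vanGeemenVerra2003QuaternionicPryms, Lemma 4.5] -/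
def quatBasis : QuaternionAlgebra.Basis (W →ₗ[ℝ] W) (-d) 0 b where
  i := F.A
  j := F.B
  k := F.A * F.B
  i_mul_i := by ext w; simp [F.A_A]
  j_mul_j := by ext w; simp [F.B_B]
  i_mul_j := rfl
  j_mul_i := by ext w; simp [F.A_B]

/-- The left action `λ : D_ℝ → End_ℝ(W)`, `i ↦ A`, `j ↦ B`. [cite: vanGeemenVerra2003QuaternionicPryms, Lemma 4.5] -/
def lam : ℍ[ℝ,-d,b] →ₐ[ℝ] (W →ₗ[ℝ] W) := F.quatBasis.liftHom

/-- `lam_apply` (auxiliary). [cite: vanGeemen1994HodgeAV, 5.3–5.6] -/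
theorem lam_apply (δ : ℍ[ℝ,-d,b]) (w : W) :
    F.lam δ w = δ.re • w + δ.imI • F.A w + δ.imJ • F.B w + δ.imK • F.A (F.B w) := by
  simp [lam, QuaternionAlgebra.Basis.liftHom_apply, QuaternionAlgebra.Basis.lift, quatBasis,
    Algebra.algebraMap_eq_smul_one]

/-- `lam_qi` (auxiliary). [cite: vanGeemen1994HodgeAV, 5.3–5.6] -/
theorem lam_qi : F.lam (qi d b) = F.A := by ext w; simp [lam_apply, qi]
/-- `lam_qj` (auxiliary). [cite: vanGeemen1994HodgeAV, 5.3–5.6] -/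
theorem lam_qj : F.lam (qj d b) = F.B := by ext w; simp [lam_apply, qj]

/-- ADJOINT: `E(λ(δ)v, w) = E(v, λ(δ†)w)`. [cite: vanGeemen1994HodgeAV, 5.6] -/
theorem E_lam (δ : ℍ[ℝ,-d,b]) (v w : W) : F.E (F.lam δ v) w = F.E v (F.lam (dag δ) w) := by
  have h1 := F.E_A v w
  have h2 := F.E_B v w
  have h4 : F.B (F.A w) = -(F.A (F.B w)) := by rw [F.A_B, neg_neg]
  have h3 : F.E (F.A (F.B v)) w = F.E v (F.A (F.B w)) := by
    rw [F.E_A, F.E_B, h4, map_neg, neg_neg]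
  simp only [lam_apply, map_add, map_smul, LinearMap.add_apply, LinearMap.smul_apply, smul_eq_mul,
    dag_re, dag_imI, dag_imJ, dag_imK]
  rw [h1, h2, h3]; ring

/-- The coordinate isomorphism `Φ : D_ℝⁿ ≃ W` (componentwise `D_ℝ ≃ ℝ⁴`, then the frame basis). [cite: vanGeemen1994HodgeAV, 5.3–5.6] -/
def Φ : (Fin n → ℍ[ℝ,-d,b]) ≃ₗ[ℝ] W :=
  ((LinearEquiv.piCongrRight fun _ : Fin n => QuaternionAlgebra.linearEquivTuple (-d) (0 : ℝ) b).trans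
    (LinearEquiv.curry ℝ ℝ (Fin n) (Fin 4)).symm).trans F.bas.equivFun.symm

/-- `lam_coord` (auxiliary). [cite: vanGeemen1994HodgeAV, 5.3–5.6] -/
theorem lam_coord (i : Fin n) (δ : ℍ[ℝ,-d,b]) :
    F.lam δ (F.x i) = ∑ ε : Fin 4, (QuaternionAlgebra.equivTuple (-d) (0 : ℝ) b δ ε) • F.bas (i, ε) := by
  simp only [lam_apply, QuaternionAlgebra.equivTuple_apply, Fin.sum_univ_four, Matrix.cons_val_zero,
    Matrix.cons_val_one, Matrix.cons_val, x]
  rw [F.bas_one, F.bas_two, F.bas_three]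

/-- `Φ(g) = Σᵢ λ(gᵢ) xᵢ`. [cite: vanGeemen1994HodgeAV, 5.3–5.6] -/
theorem Φ_apply (g : Fin n → ℍ[ℝ,-d,b]) : F.Φ g = ∑ i, F.lam (g i) (F.x i) := by
  simp only [Φ, LinearEquiv.trans_apply, Module.Basis.equivFun_symm_apply, LinearEquiv.coe_curry_symm,
    Fintype.sum_prod_type, lam_coord]
  rfl

/-- `Φ_single` (auxiliary). [cite: vanGeemen1994HodgeAV, 5.3–5.6] -/
theorem Φ_single (i : Fin n) (δ : ℍ[ℝ,-d,b]) : F.Φ (Pi.single i δ) = F.lam δ (F.x i) := by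
  rw [Φ_apply, Finset.sum_eq_single i]
  · simp
  · intro k _ hk; simp [Pi.single_eq_of_ne hk]
  · intro h; exact absurd (Finset.mem_univ i) h

/-- `Φ` is left `D_ℝ`-linear: `Φ(δ g) = λ(δ) Φ(g)`. [cite: vanGeemen1994HodgeAV, 5.3–5.6] -/
theorem Φ_smul_left (δ : ℍ[ℝ,-d,b]) (g : Fin n → ℍ[ℝ,-d,b]) : F.Φ (δ • g) = F.lam δ (F.Φ g) := by
  simp only [Φ_apply, Pi.smul_apply, smul_eq_mul, map_mul, map_sum, Module.End.mul_apply]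

/-- The `D_ℝ`-linear operator `ρ(M) : Φ(g) ↦ Φ(g M)`. [cite: vanGeemen1994HodgeAV, 5.9–5.10] -/
def ρ (M : Matrix (Fin n) (Fin n) ℍ[ℝ,-d,b]) : W →ₗ[ℝ] W :=
  F.Φ.toLinearMap ∘ₗ vecMulₗ M ∘ₗ F.Φ.symm.toLinearMap

/-- `ρ_apply` (auxiliary). [cite: vanGeemen1994HodgeAV, 5.3–5.6] -/
theorem ρ_apply (M : Matrix (Fin n) (Fin n) ℍ[ℝ,-d,b]) (w : W) :
    F.ρ M w = F.Φ (F.Φ.symm w ᵥ* M) := rfl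

/-- `ρ_Φ` (auxiliary). [cite: vanGeemen1994HodgeAV, 5.3–5.6] -/
theorem ρ_Φ (M : Matrix (Fin n) (Fin n) ℍ[ℝ,-d,b]) (g : Fin n → ℍ[ℝ,-d,b]) :
    F.ρ M (F.Φ g) = F.Φ (g ᵥ* M) := by
  simp [ρ_apply]

/-- `ρ_mul` (auxiliary). [cite: vanGeemen1994HodgeAV, 5.3–5.6] -/
theorem ρ_mul (M N : Matrix (Fin n) (Fin n) ℍ[ℝ,-d,b]) : F.ρ M * F.ρ N = F.ρ (N * M) := by
  ext w; simp [ρ_apply, Matrix.vecMul_vecMul]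

/-- `ρ_comp` (auxiliary). [cite: vanGeemen1994HodgeAV, 5.3–5.6] -/
theorem ρ_comp (M N : Matrix (Fin n) (Fin n) ℍ[ℝ,-d,b]) : F.ρ M ∘ₗ F.ρ N = F.ρ (N * M) :=
  F.ρ_mul M N

/-- `ρ_one` (auxiliary). [cite: vanGeemen1994HodgeAV, 5.3–5.6] -/
theorem ρ_one : F.ρ 1 = LinearMap.id := by ext w; simp [ρ_apply]

/-- `ρ_add` (auxiliary). [cite: vanGeemen1994HodgeAV, 5.3–5.6] -/
theorem ρ_add (M N : Matrix (Fin n) (Fin n) ℍ[ℝ,-d,b]) : F.ρ (M + N) = F.ρ M + F.ρ N := by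
  ext w; simp [ρ_apply, Matrix.vecMul_add]

/-- `ρ_smul` (auxiliary). [cite: vanGeemen1994HodgeAV, 5.3–5.6] -/
theorem ρ_smul (r : ℝ) (M : Matrix (Fin n) (Fin n) ℍ[ℝ,-d,b]) : F.ρ (r • M) = r • F.ρ M := by
  ext w; simp [ρ_apply, Matrix.vecMul_smul]

/-- `ρ_zero` (auxiliary). [cite: vanGeemen1994HodgeAV, 5.3–5.6] -/
theorem ρ_zero : F.ρ 0 = 0 := by ext w; simp [ρ_apply]

/-- `ρ_neg` (auxiliary). [cite: vanGeemen1994HodgeAV, 5.3–5.6] -/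
theorem ρ_neg (M : Matrix (Fin n) (Fin n) ℍ[ℝ,-d,b]) : F.ρ (-M) = -F.ρ M := by
  ext w; simp [ρ_apply, Matrix.vecMul_neg]

/-- `ρ_sub` (auxiliary). [cite: vanGeemen1994HodgeAV, 5.3–5.6] -/
theorem ρ_sub (M N : Matrix (Fin n) (Fin n) ℍ[ℝ,-d,b]) : F.ρ (M - N) = F.ρ M - F.ρ N := by
  rw [sub_eq_add_neg, ρ_add, ρ_neg, ← sub_eq_add_neg]

/-- `ρ_sum` (auxiliary). [cite: vanGeemen1994HodgeAV, 5.3–5.6] -/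
theorem ρ_sum {ι : Type*} (s : Finset ι) (M : ι → Matrix (Fin n) (Fin n) ℍ[ℝ,-d,b]) :
    F.ρ (∑ a ∈ s, M a) = ∑ a ∈ s, F.ρ (M a) := by
  classical
  induction s using Finset.induction_on with
  | empty => simp [ρ_zero]
  | insert a s ha ih => rw [Finset.sum_insert ha, Finset.sum_insert ha, ρ_add, ih]

/-- `ρ(M)` commutes with the left action `λ`. [cite: vanGeemen1994HodgeAV, 5.3–5.6] -/
theorem lam_ρ (δ : ℍ[ℝ,-d,b]) (M : Matrix (Fin n) (Fin n) ℍ[ℝ,-d,b]) (w : W) :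
    F.lam δ (F.ρ M w) = F.ρ M (F.lam δ w) := by
  obtain ⟨g, rfl⟩ := F.Φ.surjective w
  rw [ρ_Φ, ← Φ_smul_left, ← Φ_smul_left, ρ_Φ, smul_vecMul_quat]

/-- `lam_comp_ρ` (auxiliary). [cite: vanGeemen1994HodgeAV, 5.3–5.6] -/
theorem lam_comp_ρ (δ : ℍ[ℝ,-d,b]) (M : Matrix (Fin n) (Fin n) ℍ[ℝ,-d,b]) :
    F.lam δ ∘ₗ F.ρ M = F.ρ M ∘ₗ F.lam δ := by
  ext w; exact F.lam_ρ δ M w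

/-! ### The Gram formula `E(Φ g, Φ h) = Σᵢ qᵢ (gᵢ† hᵢ).imI` -/

/-- The coordinate form `⟪g, h⟫ = Σᵢ qᵢ (gᵢ† hᵢ).imI`. [cite: vanGeemen1994HodgeAV, 5.3–5.6] -/
def ip (g h : Fin n → ℍ[ℝ,-d,b]) : ℝ := ∑ i, F.q i * (dag (g i) * h i).imI

/-- `E(xᵢ, λ(δ) xₖ) = [i = k] qᵢ δ.imI`. [cite: vanGeemen1994HodgeAV, 5.6] -/
theorem E_x_lam (i k : Fin n) (δ : ℍ[ℝ,-d,b]) :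
    F.E (F.x i) (F.lam δ (F.x k)) = if i = k then F.q i * δ.imI else 0 := by
  split_ifs with hik
  · subst hik
    have h0 : F.E (F.x i) (F.x i) = 0 := by
      have := F.E_swap (F.x i) (F.x i); linarith
    have h2 : F.E (F.x i) (F.B (F.x i)) = 0 := by
      have := F.E_swap (F.x i) (F.B (F.x i)); rw [F.E_B] at this; linarith
    have h3 : F.E (F.x i) (F.A (F.B (F.x i))) = 0 := by
      have e1 := F.E_swap (F.x i) (F.A (F.B (F.x i)))
      have e2 := F.E_A (F.B (F.x i)) (F.x i)
      have e3 := F.E_B (F.x i) (F.A (F.x i))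
      have e4 : F.B (F.A (F.x i)) = -(F.A (F.B (F.x i))) := by rw [F.A_B, neg_neg]
      rw [e4, map_neg] at e3
      linarith
    simp only [lam_apply, map_add, map_smul, smul_eq_mul, h0, h2, h3, q]; ring
  · have h := fun ε ε' => F.orth i k hik ε ε'
    have e0 := h 0 0; have e1 := h 0 1; have e2 := h 0 2; have e3 := h 0 3
    rw [F.bas_one, F.bas_two, F.bas_three] at *
    simp only [lam_apply, map_add, map_smul, smul_eq_mul, x]
    rw [e0, e1, e2, e3]; ring

/-- THE GRAM FORMULA `E(Φ g, Φ h) = ⟪g, h⟫`. [cite: vanGeemen1994HodgeAV, 5.6] -/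
theorem E_Φ (g h : Fin n → ℍ[ℝ,-d,b]) : F.E (F.Φ g) (F.Φ h) = F.ip g h := by
  calc F.E (F.Φ g) (F.Φ h)
      = ∑ i, ∑ k, F.E (F.lam (g i) (F.x i)) (F.lam (h k) (F.x k)) := by
        simp only [Φ_apply, map_sum, LinearMap.sum_apply]
        exact Finset.sum_comm
    _ = ∑ i, ∑ k, (if i = k then F.q i * (dag (g i) * h k).imI else 0) := by
        refine Finset.sum_congr rfl fun i _ => Finset.sum_congr rfl fun k _ => ?_
        rw [E_lam, ← Module.End.mul_apply, ← map_mul, E_x_lam]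
    _ = F.ip g h := by simp [ip, Finset.sum_ite_eq]

/-- `ip_add_left` (auxiliary). [cite: vanGeemen1994HodgeAV, 5.3–5.6] -/
theorem ip_add_left (g g' h : Fin n → ℍ[ℝ,-d,b]) : F.ip (g + g') h = F.ip g h + F.ip g' h := by
  simp [ip, dag_add, add_mul, Finset.sum_add_distrib, mul_add]

/-- `ip_add_right` (auxiliary). [cite: vanGeemen1994HodgeAV, 5.3–5.6] -/
theorem ip_add_right (g h h' : Fin n → ℍ[ℝ,-d,b]) : F.ip g (h + h') = F.ip g h + F.ip g h' := by
  simp [ip, mul_add, Finset.sum_add_distrib]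

/-- `ip_smul_left` (auxiliary). [cite: vanGeemen1994HodgeAV, 5.3–5.6] -/
theorem ip_smul_left (r : ℝ) (g h : Fin n → ℍ[ℝ,-d,b]) : F.ip (r • g) h = r * F.ip g h := by
  simp [ip, dag_smul, Finset.mul_sum, mul_left_comm]

/-- `ip_smul_right` (auxiliary). [cite: vanGeemen1994HodgeAV, 5.3–5.6] -/
theorem ip_smul_right (r : ℝ) (g h : Fin n → ℍ[ℝ,-d,b]) : F.ip g (r • h) = r * F.ip g h := by
  simp [ip, Finset.mul_sum, mul_left_comm]

/-- An operator `ρ(M)` with `⟪gM, hM⟫ = ⟪g, h⟫` is an `E`-isometry. [cite: vanGeemen1994HodgeAV, 5.3–5.6] -/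
theorem E_ρ_ρ (M : Matrix (Fin n) (Fin n) ℍ[ℝ,-d,b])
    (hM : ∀ g h, F.ip (g ᵥ* M) (h ᵥ* M) = F.ip g h) (v w : W) :
    F.E (F.ρ M v) (F.ρ M w) = F.E v w := by
  obtain ⟨g, rfl⟩ := F.Φ.surjective v
  obtain ⟨h, rfl⟩ := F.Φ.surjective w
  rw [ρ_Φ, ρ_Φ, E_Φ, E_Φ, hM]

/-! ## §2 The explicit family: `Dq = diag(i)`, the torus `Γ`, the unipotent direction `σ`, and `J(t)` -/

/-- `Dq = diag(i, …, i)` (the base point `J₁ = d^{-1/2} ρ(Dq)` is the diagonal CM point of `𝔖(j)`). [cite: vanGeemen1994HodgeAV, proof of Thm. 6.11] -/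
def Dq : Matrix (Fin n) (Fin n) ℍ[ℝ,-d,b] := Matrix.diagonal fun _ => qi d b

/-- `⟪g Dq, h Dq⟫ = d ⟪g, h⟫`. [cite: vanGeemen1994HodgeAV, proof of Thm. 6.11] -/
theorem ip_Dq (g h : Fin n → ℍ[ℝ,-d,b]) : F.ip (g ᵥ* Dq) (h ᵥ* Dq) = d * F.ip g h := by
  simp only [Dq, Matrix.vecMul_diagonal, ip, dag_mul, dag_qi, Finset.mul_sum]
  refine Finset.sum_congr rfl fun i _ => ?_
  rw [show -qi d b * dag (g i) * (h i * qi d b) = -(qi d b * (dag (g i) * h i) * qi d b) by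
    noncomm_ring, neg_imI', imI_qi_mul_mul_qi]; ring

/-- `ip_self_Dq` (auxiliary). [cite: vanGeemen1994HodgeAV, proof of Thm. 6.11] -/
theorem ip_self_Dq (h : Fin n → ℍ[ℝ,-d,b]) : F.ip h (h ᵥ* Dq) =
    ∑ i, F.q i * ((h i).re ^ 2 + d * (h i).imI ^ 2 + b * (h i).imJ ^ 2 + b * d * (h i).imK ^ 2) := by
  simp only [ip, Dq, Matrix.vecMul_diagonal, ← mul_assoc, imI_dag_mul_self_mul_qi]

/-- POSITIVITY of the base point: `⟪h, h Dq⟫ > 0` for `h ≠ 0`. [cite: vanGeemen1994HodgeAV, 5.6–5.7] -/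
theorem ip_self_Dq_pos (h : Fin n → ℍ[ℝ,-d,b]) (hh : h ≠ 0) : 0 < F.ip h (h ᵥ* Dq) := by
  rw [ip_self_Dq]
  obtain ⟨i, hi⟩ : ∃ i, h i ≠ 0 := Function.ne_iff.mp hh
  have hd := F.d_pos; have hb := F.b_pos
  have hnn : ∀ k, 0 ≤ F.q k *
      ((h k).re ^ 2 + d * (h k).imI ^ 2 + b * (h k).imJ ^ 2 + b * d * (h k).imK ^ 2) :=
    fun k => mul_nonneg (F.q_pos k).le (by positivity)
  refine lt_of_lt_of_le ?_ (Finset.single_le_sum (fun k _ => hnn k) (Finset.mem_univ i))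
  refine mul_pos (F.q_pos i) ?_
  have hc : (h i).re ≠ 0 ∨ (h i).imI ≠ 0 ∨ (h i).imJ ≠ 0 ∨ (h i).imK ≠ 0 := by
    contrapose! hi
    exact QuaternionAlgebra.ext hi.1 hi.2.1 hi.2.2.1 hi.2.2.2
  rcases hc with h1 | h1 | h1 | h1
  · have : 0 < (h i).re ^ 2 := by positivity
    nlinarith [sq_nonneg (h i).imI, sq_nonneg (h i).imJ, sq_nonneg (h i).imK, mul_pos hb hd]
  · have : 0 < (h i).imI ^ 2 := by positivity
    nlinarith [sq_nonneg (h i).re, sq_nonneg (h i).imJ, sq_nonneg (h i).imK, mul_pos hb hd]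
  · have : 0 < (h i).imJ ^ 2 := by positivity
    nlinarith [sq_nonneg (h i).re, sq_nonneg (h i).imI, sq_nonneg (h i).imK, mul_pos hb hd]
  · have : 0 < (h i).imK ^ 2 := by positivity
    nlinarith [sq_nonneg (h i).re, sq_nonneg (h i).imI, sq_nonneg (h i).imJ, mul_pos hb hd]

/-- `Dq_mul_Dq` (auxiliary). [cite: vanGeemen1994HodgeAV, proof of Thm. 6.11] -/
theorem Dq_mul_Dq : (Dq : Matrix (Fin n) (Fin n) ℍ[ℝ,-d,b]) * Dq = (-d) • 1 := by
  rw [Dq, Matrix.diagonal_mul_diagonal]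
  refine Matrix.ext fun i k => ?_
  by_cases hik : i = k
  · subst hik; simp [qi_mul_qi]
  · simp [Matrix.diagonal_apply_ne _ hik, Matrix.one_apply_ne hik]

/-- The torus `Γ(P) = diag(γ(Pᵢ))`. [cite: vanGeemen1994HodgeAV, proof of Thm. 6.11] -/
def Γ (_F : Frame W n d b β) (P : Fin n → ℝ) : Matrix (Fin n) (Fin n) ℍ[ℝ,-d,b] :=
  Matrix.diagonal fun i => gam d b β (P i)

/-- `Γ(P)` is an isometry of `⟪·,·⟫`. [cite: vanGeemen1994HodgeAV, proof of Thm. 6.11] -/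
theorem ip_Γ (P : Fin n → ℝ) (hP : ∀ i, P i ≠ 0) (g h : Fin n → ℍ[ℝ,-d,b]) :
    F.ip (g ᵥ* F.Γ P) (h ᵥ* F.Γ P) = F.ip g h := by
  simp only [Γ, Matrix.vecMul_diagonal, ip]
  refine Finset.sum_congr rfl fun i _ => ?_
  rw [dag_mul, dag_gam, show gam d b β (P i) * dag (g i) * (h i * gam d b β (P i)) =
    gam d b β (P i) * (dag (g i) * h i) * gam d b β (P i) by noncomm_ring,
    imI_gam_sandwich F.β_mul_β F.β_ne (hP i)]

/-- `Γ_mul_Γ_inv` (auxiliary). [cite: vanGeemen1994HodgeAV, proof of Thm. 6.11] -/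
theorem Γ_mul_Γ_inv (P : Fin n → ℝ) (hP : ∀ i, P i ≠ 0) :
    F.Γ P * F.Γ (fun i => (P i)⁻¹) = 1 := by
  rw [Γ, Γ, Matrix.diagonal_mul_diagonal, ← Matrix.diagonal_one]
  congr 1; funext i; exact gam_mul_gam_inv F.β_mul_β F.β_ne (hP i)

/-- `Γ_inv_mul_Γ` (auxiliary). [cite: vanGeemen1994HodgeAV, proof of Thm. 6.11] -/
theorem Γ_inv_mul_Γ (P : Fin n → ℝ) (hP : ∀ i, P i ≠ 0) :
    F.Γ (fun i => (P i)⁻¹) * F.Γ P = 1 := by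
  rw [Γ, Γ, Matrix.diagonal_mul_diagonal, ← Matrix.diagonal_one]
  congr 1; funext i; exact gam_inv_mul_gam F.β_mul_β F.β_ne (hP i)

section Unipotent

variable [NeZero n]

/-- The nilpotent `σ`: `σᵢ₀ = u₊` (`i ≠ 0`), `σ₀ₖ = -(q₀/qₖ) u₋` (`k ≠ 0`), zero elsewhere — an `E`-skew
square-zero element of `Mₙ(D_ℝ)` gluing block `0` to every other block.
[cite: vanGeemen1994HodgeAV, proof of Thm. 6.11] -/
def σ : Matrix (Fin n) (Fin n) ℍ[ℝ,-d,b] := Matrix.of fun i k =>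
  if i ≠ 0 ∧ k = 0 then up d b β else if i = 0 ∧ k ≠ 0 then -((F.q 0 / F.q k) • um d b β) else 0

/-- `σ_zero_zero` (auxiliary). [cite: vanGeemen1994HodgeAV, proof of Thm. 6.11] -/
theorem σ_zero_zero : F.σ 0 0 = 0 := by simp [σ]
/-- `σ_ne_zero` (auxiliary). [cite: vanGeemen1994HodgeAV, proof of Thm. 6.11] -/
theorem σ_ne_zero {i : Fin n} (hi : i ≠ 0) : F.σ i 0 = up d b β := by simp [σ, hi]
/-- `σ_zero_ne` (auxiliary). [cite: vanGeemen1994HodgeAV, proof of Thm. 6.11] -/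
theorem σ_zero_ne {k : Fin n} (hk : k ≠ 0) : F.σ 0 k = -((F.q 0 / F.q k) • um d b β) := by
  simp [σ, hk]
/-- `σ_ne_ne` (auxiliary). [cite: vanGeemen1994HodgeAV, proof of Thm. 6.11] -/
theorem σ_ne_ne {i k : Fin n} (hi : i ≠ 0) (hk : k ≠ 0) : F.σ i k = 0 := by simp [σ, hi, hk]

/-- `vecMul_σ_zero` (auxiliary). [cite: vanGeemen1994HodgeAV, proof of Thm. 6.11] -/
theorem vecMul_σ_zero (g : Fin n → ℍ[ℝ,-d,b]) :
    (g ᵥ* F.σ) 0 = ∑ i ∈ Finset.univ.erase 0, g i * up d b β := by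
  simp only [Matrix.vecMul, dotProduct]
  rw [← Finset.add_sum_erase _ _ (Finset.mem_univ (0 : Fin n)), σ_zero_zero, mul_zero, zero_add]
  exact Finset.sum_congr rfl fun i hi => by rw [F.σ_ne_zero (Finset.ne_of_mem_erase hi)]

/-- `vecMul_σ_ne` (auxiliary). [cite: vanGeemen1994HodgeAV, proof of Thm. 6.11] -/
theorem vecMul_σ_ne (g : Fin n → ℍ[ℝ,-d,b]) {k : Fin n} (hk : k ≠ 0) :
    (g ᵥ* F.σ) k = -((F.q 0 / F.q k) • (g 0 * um d b β)) := by
  simp only [Matrix.vecMul, dotProduct]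
  rw [← Finset.add_sum_erase _ _ (Finset.mem_univ (0 : Fin n)), F.σ_zero_ne hk,
    Finset.sum_eq_zero fun i hi => by rw [F.σ_ne_ne (Finset.ne_of_mem_erase hi) hk, mul_zero]]
  simp [mul_neg]

/-- `σ² = 0`. [cite: vanGeemen1994HodgeAV, proof of Thm. 6.11] -/
theorem σ_mul_σ : F.σ * F.σ = 0 := by
  refine Matrix.ext fun i k => ?_
  simp only [Matrix.mul_apply, Matrix.zero_apply]
  refine Finset.sum_eq_zero fun l _ => ?_
  rcases eq_or_ne l 0 with rfl | hl
  · rcases eq_or_ne i 0 with rfl | hi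
    · rw [σ_zero_zero, zero_mul]
    · rw [F.σ_ne_zero hi]
      rcases eq_or_ne k 0 with rfl | hk
      · rw [σ_zero_zero, mul_zero]
      · rw [F.σ_zero_ne hk, mul_neg, mul_smul_comm, up_mul_um F.β_mul_β F.β_ne, smul_zero, neg_zero]
  · rcases eq_or_ne i 0 with rfl | hi
    · rw [F.σ_zero_ne hl]
      rcases eq_or_ne k 0 with rfl | hk
      · rw [F.σ_ne_zero hl, neg_mul, smul_mul_assoc, um_mul_up F.β_mul_β F.β_ne, smul_zero, neg_zero]
      · rw [F.σ_ne_ne hl hk, mul_zero]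
    · rw [F.σ_ne_ne hi hl, zero_mul]

/-- `ip_split` (auxiliary). [cite: vanGeemen1994HodgeAV, proof of Thm. 6.11] -/
theorem ip_split (g h : Fin n → ℍ[ℝ,-d,b]) : F.ip g h =
    F.q 0 * (dag (g 0) * h 0).imI + ∑ k ∈ Finset.univ.erase 0, F.q k * (dag (g k) * h k).imI :=
  (Finset.add_sum_erase _ _ (Finset.mem_univ (0 : Fin n))).symm

/-- `σ` is `E`-SKEW: `⟪gσ, h⟫ + ⟪g, hσ⟫ = 0`. [cite: vanGeemen1994HodgeAV, proof of Thm. 6.11] -/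
theorem ip_σ_skew (g h : Fin n → ℍ[ℝ,-d,b]) : F.ip (g ᵥ* F.σ) h + F.ip g (h ᵥ* F.σ) = 0 := by
  have hq0 := F.q_ne 0
  have e1 : F.ip (g ᵥ* F.σ) h =
      F.q 0 * ∑ i ∈ Finset.univ.erase 0, (dag (g i) * h 0 * um d b β).imI
        - F.q 0 * ∑ k ∈ Finset.univ.erase 0, (um d b β * (dag (g 0) * h k)).imI := by
    rw [ip_split, vecMul_σ_zero, dag_sum, Finset.sum_mul, imI_sum]
    congr 1
    · congr 1
      refine Finset.sum_congr rfl fun i _ => ?_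
      rw [dag_mul, dag_up, mul_assoc, imI_up_mul]
    · rw [Finset.mul_sum, ← Finset.sum_neg_distrib]
      refine Finset.sum_congr rfl fun k hk => ?_
      have hqk := F.q_ne k
      rw [F.vecMul_σ_ne g (Finset.ne_of_mem_erase hk), dag_neg, dag_smul, dag_mul, dag_um, neg_mul,
        smul_mul_assoc, neg_imI', smul_imI', mul_assoc]
      field_simp
  have e2 : F.ip g (h ᵥ* F.σ) =
      F.q 0 * ∑ i ∈ Finset.univ.erase 0, (um d b β * (dag (g 0) * h i)).imI
        - F.q 0 * ∑ k ∈ Finset.univ.erase 0, (dag (g k) * h 0 * um d b β).imI := by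
    rw [ip_split, vecMul_σ_zero, Finset.mul_sum, imI_sum]
    congr 1
    · congr 1
      refine Finset.sum_congr rfl fun i _ => ?_
      rw [← mul_assoc, imI_mul_up]
    · rw [Finset.mul_sum, ← Finset.sum_neg_distrib]
      refine Finset.sum_congr rfl fun k hk => ?_
      have hqk := F.q_ne k
      rw [F.vecMul_σ_ne h (Finset.ne_of_mem_erase hk), mul_neg, mul_smul_comm, neg_imI', smul_imI',
        mul_assoc]
      field_simp
  rw [e1, e2]; ring

/-- `σ` is `E`-NULL: `⟪gσ, hσ⟫ = 0`. [cite: vanGeemen1994HodgeAV, proof of Thm. 6.11] -/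
theorem ip_σ_null (g h : Fin n → ℍ[ℝ,-d,b]) : F.ip (g ᵥ* F.σ) (h ᵥ* F.σ) = 0 := by
  rw [ip_split, vecMul_σ_zero, vecMul_σ_zero]
  have t1 : (dag (∑ i ∈ Finset.univ.erase (0 : Fin n), g i * up d b β) *
      ∑ i ∈ Finset.univ.erase (0 : Fin n), h i * up d b β).imI = 0 := by
    rw [dag_sum, Finset.sum_mul, imI_sum]
    refine Finset.sum_eq_zero fun i _ => ?_
    rw [Finset.mul_sum, imI_sum]
    refine Finset.sum_eq_zero fun k _ => ?_
    rw [dag_mul, dag_up, show up d b β * dag (g i) * (h k * up d b β) =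
      up d b β * (dag (g i) * h k) * up d b β by noncomm_ring]
    exact imI_up_sandwich F.β_mul_β F.β_ne _
  have t2 : ∀ k ∈ Finset.univ.erase (0 : Fin n),
      F.q k * (dag ((g ᵥ* F.σ) k) * (h ᵥ* F.σ) k).imI = 0 := by
    intro k hk
    rw [F.vecMul_σ_ne g (Finset.ne_of_mem_erase hk), F.vecMul_σ_ne h (Finset.ne_of_mem_erase hk),
      dag_neg, dag_smul, dag_mul, dag_um, neg_mul, mul_neg, neg_neg, smul_mul_assoc, mul_smul_comm,
      smul_imI', smul_imI',
      show um d b β * dag (g 0) * (h 0 * um d b β) = um d b β * (dag (g 0) * h 0) * um d b β by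
        noncomm_ring, imI_um_sandwich F.β_mul_β F.β_ne, mul_zero, mul_zero, mul_zero]
  rw [t1, mul_zero, zero_add]
  exact Finset.sum_eq_zero t2

/-- The unipotent `1 + tσ` is an isometry of `⟪·,·⟫`. [cite: vanGeemen1994HodgeAV, proof of Thm. 6.11] -/
theorem ip_unipotent (t : ℝ) (g h : Fin n → ℍ[ℝ,-d,b]) :
    F.ip (g ᵥ* (1 + t • F.σ)) (h ᵥ* (1 + t • F.σ)) = F.ip g h := by
  simp only [Matrix.vecMul_add, Matrix.vecMul_one, Matrix.vecMul_smul]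
  rw [ip_add_left, ip_add_right, ip_add_right, ip_smul_left, ip_smul_right, ip_smul_left,
    ip_smul_right]
  have h1 := F.ip_σ_skew g h
  have h2 := F.ip_σ_null g h
  linear_combination t * h1 + t * t * h2

/-- `unipotent_mul` (auxiliary). [cite: vanGeemen1994HodgeAV, proof of Thm. 6.11] -/
theorem unipotent_mul (t : ℝ) : (1 + t • F.σ) * (1 - t • F.σ) = 1 := by
  have h : (t • F.σ) * (t • F.σ) = 0 := by
    rw [Matrix.smul_mul, Matrix.mul_smul, σ_mul_σ, smul_zero, smul_zero]
  rw [mul_sub, add_mul, add_mul, one_mul, mul_one, one_mul, h]; abel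

/-- `unipotent_mul'` (auxiliary). [cite: vanGeemen1994HodgeAV, proof of Thm. 6.11] -/
theorem unipotent_mul' (t : ℝ) : (1 - t • F.σ) * (1 + t • F.σ) = 1 := by
  have := F.unipotent_mul (-t)
  simpa [sub_eq_add_neg] using this

/-! ### The family `J(t)` -/

/-- The exponents `e(0) = 1`, `e(i) = 2i + 2`. [cite: vanGeemen1994HodgeAV, proof of Thm. 6.11] -/
def ex (i : Fin n) : ℕ := if (i : ℕ) = 0 then 1 else 2 * (i : ℕ) + 2

/-- `Pᵢ(t) = t^{e(i)}`. [cite: vanGeemen1994HodgeAV, proof of Thm. 6.11] -/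
def Pv (t : ℝ) (i : Fin n) : ℝ := t ^ ex i

omit [NeZero n] in
/-- `Pv_ne` (auxiliary). [cite: vanGeemen1994HodgeAV, proof of Thm. 6.11] -/
theorem Pv_ne {t : ℝ} (ht : t ≠ 0) (i : Fin n) : Pv t i ≠ 0 := pow_ne_zero _ ht

/-- The matrix `m(t) = (1 - tσ) Γ(P)⁻¹ Dq Γ(P) (1 + tσ)` of `J(t)`. [cite: vanGeemen1994HodgeAV, proof of Thm. 6.11] -/
def mMat (t : ℝ) : Matrix (Fin n) (Fin n) ℍ[ℝ,-d,b] :=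
  (1 - t • F.σ) * (F.Γ (fun i => (Pv t i)⁻¹) * Dq * F.Γ (Pv t)) * (1 + t • F.σ)

/-- **The type-II family** `J(t) = d^{-1/2} ρ(m(t))`, `t > 0`. [cite: vanGeemen1994HodgeAV, proof of Thm. 6.11]
[cite: Shimura1963AnalyticFamilies, §4] -/
def J (t : ℝ) : W →ₗ[ℝ] W := (Real.sqrt d)⁻¹ • F.ρ (F.mMat t)

omit [NeZero n] in
/-- `sqrt_d_pos` (auxiliary). [cite: vanGeemen1994HodgeAV, proof of Thm. 6.11] -/
theorem sqrt_d_pos (F : Frame W n d b β) : 0 < Real.sqrt d := Real.sqrt_pos.2 F.d_pos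
omit [NeZero n] in
/-- `inv_sqrt_mul_inv_sqrt_mul_d` (auxiliary). [cite: vanGeemen1994HodgeAV, proof of Thm. 6.11] -/
theorem inv_sqrt_mul_inv_sqrt_mul_d (F : Frame W n d b β) :
    (Real.sqrt d)⁻¹ * (Real.sqrt d)⁻¹ * d = 1 := by
  have h := Real.mul_self_sqrt F.d_pos.le
  have h0 : Real.sqrt d ≠ 0 := F.sqrt_d_pos.ne'
  field_simp; linarith

/-- `mMat_mul_mMat` (auxiliary). [cite: vanGeemen1994HodgeAV, proof of Thm. 6.11] -/
theorem mMat_mul_mMat {t : ℝ} (ht : t ≠ 0) :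
    F.mMat t * F.mMat t = (-d) • (1 : Matrix (Fin n) (Fin n) ℍ[ℝ,-d,b]) := by
  have hP := Pv_ne (n := n) ht
  have hPi : ∀ i, (Pv t i)⁻¹ ≠ 0 := fun i => inv_ne_zero (hP i)
  have h1 : ∀ X : Matrix (Fin n) (Fin n) ℍ[ℝ,-d,b], (1 + t • F.σ) * ((1 - t • F.σ) * X) = X :=
    fun X => by rw [← mul_assoc, unipotent_mul, one_mul]
  have h2 : ∀ X : Matrix (Fin n) (Fin n) ℍ[ℝ,-d,b],
      F.Γ (Pv t) * (F.Γ (fun i => (Pv t i)⁻¹) * X) = X :=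
    fun X => by rw [← mul_assoc, Γ_mul_Γ_inv _ _ hP, one_mul]
  have h3 : ∀ X : Matrix (Fin n) (Fin n) ℍ[ℝ,-d,b], Dq * (Dq * X) = (-d) • X :=
    fun X => by rw [← mul_assoc, Dq_mul_Dq, smul_mul_assoc, one_mul]
  have h2' : ∀ X : Matrix (Fin n) (Fin n) ℍ[ℝ,-d,b],
      F.Γ (fun i => (Pv t i)⁻¹) * (F.Γ (Pv t) * X) = X :=
    fun X => by rw [← mul_assoc, Γ_inv_mul_Γ _ _ hP, one_mul]
  simp only [mMat, mul_assoc]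
  rw [h1, h2, h3, Matrix.mul_smul, Matrix.mul_smul, h2', unipotent_mul']

/-- `J(t)² = -1`. [cite: vanGeemen1994HodgeAV, 5.5] -/
theorem J_J {t : ℝ} (ht : 0 < t) (w : W) : F.J t (F.J t w) = -w := by
  have h := F.mMat_mul_mMat ht.ne'
  have h2 : F.ρ (F.mMat t) (F.ρ (F.mMat t) w) = -(d • w) := by
    rw [← Module.End.mul_apply, F.ρ_mul, h, F.ρ_smul, F.ρ_one, LinearMap.smul_apply,
      LinearMap.id_apply, neg_smul]
  simp only [J, LinearMap.smul_apply, map_smul, h2, smul_neg, smul_smul]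
  rw [← mul_assoc, F.inv_sqrt_mul_inv_sqrt_mul_d, one_smul]

/-- `J(t)` commutes with the left action of `D_ℝ` (in particular with `A = α` and `B = j`).
[cite: vanGeemen1994HodgeAV, 5.7] -/
theorem lam_J (t : ℝ) (δ : ℍ[ℝ,-d,b]) (w : W) : F.lam δ (F.J t w) = F.J t (F.lam δ w) := by
  simp only [J, LinearMap.smul_apply, map_smul, lam_ρ]

/-- `A_J` (auxiliary). [cite: vanGeemen1994HodgeAV, proof of Thm. 6.11] -/
theorem A_J (t : ℝ) (w : W) : F.A (F.J t w) = F.J t (F.A w) := by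
  rw [← lam_qi]; exact F.lam_J t _ w

/-- `B_J` (auxiliary). [cite: vanGeemen1994HodgeAV, proof of Thm. 6.11] -/
theorem B_J (t : ℝ) (w : W) : F.B (F.J t w) = F.J t (F.B w) := by
  rw [← lam_qj]; exact F.lam_J t _ w

/-- `⟪g m(t), h m(t)⟫ = d ⟪g, h⟫`. [cite: vanGeemen1994HodgeAV, proof of Thm. 6.11] -/
theorem ip_mMat {t : ℝ} (ht : t ≠ 0) (g h : Fin n → ℍ[ℝ,-d,b]) :
    F.ip (g ᵥ* F.mMat t) (h ᵥ* F.mMat t) = d * F.ip g h := by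
  have hP := Pv_ne (n := n) ht
  have hPi : ∀ i, (Pv t i)⁻¹ ≠ 0 := fun i => inv_ne_zero (hP i)
  simp only [mMat, ← Matrix.vecMul_vecMul]
  rw [ip_unipotent, ip_Γ _ _ hP, ip_Dq, ip_Γ _ _ hPi, sub_eq_add_neg, ← neg_smul, ip_unipotent]

/-- `E(J v, J w) = E(v, w)`. [cite: vanGeemen1994HodgeAV, 5.5–5.6] -/
theorem E_J_J {t : ℝ} (ht : 0 < t) (v w : W) : F.E (F.J t v) (F.J t w) = F.E v w := by
  obtain ⟨g, rfl⟩ := F.Φ.surjective v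
  obtain ⟨h, rfl⟩ := F.Φ.surjective w
  simp only [J, LinearMap.smul_apply, map_smul, LinearMap.smul_apply, smul_eq_mul, ρ_Φ, E_Φ]
  rw [ip_mMat _ ht.ne']
  linear_combination (F.ip g h) * F.inv_sqrt_mul_inv_sqrt_mul_d

/-- `E(v, J v) > 0` for `v ≠ 0`. [cite: vanGeemen1994HodgeAV, 5.6–5.7] -/
theorem E_J_pos {t : ℝ} (ht : 0 < t) {v : W} (hv : v ≠ 0) : 0 < F.E v (F.J t v) := by
  obtain ⟨g, rfl⟩ := F.Φ.surjective v
  have hg : g ≠ 0 := fun h => hv (by rw [h, map_zero])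
  have hP := Pv_ne (n := n) ht.ne'
  have hPi : ∀ i, (Pv t i)⁻¹ ≠ 0 := fun i => inv_ne_zero (hP i)
  set hh := (g ᵥ* (1 - t • F.σ)) ᵥ* F.Γ (fun i => (Pv t i)⁻¹) with hh_def
  have hg' : g = (hh ᵥ* F.Γ (Pv t)) ᵥ* (1 + t • F.σ) := by
    rw [hh_def, Matrix.vecMul_vecMul, Matrix.vecMul_vecMul, Matrix.vecMul_vecMul,
      ← Matrix.mul_assoc (F.Γ fun i => (Pv t i)⁻¹), Γ_inv_mul_Γ _ _ hP, Matrix.one_mul,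
      unipotent_mul', Matrix.vecMul_one]
  have hm : g ᵥ* F.mMat t = ((hh ᵥ* Dq) ᵥ* F.Γ (Pv t)) ᵥ* (1 + t • F.σ) := by
    simp only [mMat, hh_def, ← Matrix.vecMul_vecMul]
  have hhne : hh ≠ 0 := by
    intro h0
    apply hg
    have e := hg'
    rw [h0, Matrix.zero_vecMul, Matrix.zero_vecMul] at e
    exact e
  simp only [J, LinearMap.smul_apply, map_smul, smul_eq_mul, ρ_Φ, E_Φ]
  refine mul_pos (inv_pos.2 F.sqrt_d_pos) ?_
  rw [hm]
  conv_rhs => rw [hg']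
  rw [ip_unipotent, ip_Γ _ _ hP]
  exact F.ip_self_Dq_pos hh hhne

end Unipotent

end Frame

end TypeIIQuaternionFrame

end Literature.AlgebraicGeometry.Motives
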